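import Literature.Probability.RandomPlanarGeometry.PlusHullExtension
import Literature.Probability.RandomPlanarGeometry.EllipseHulls
import HarnessLib

/-!
# Proof of [LSW] Lemma 2.1 with the Lemma 3.5 convergence (`IsPlusHull.exists_antitone_isArcHull`)

Discharge of the named fact `Literature.Probability.RandomPlanarGeometry.IsPlusHull.exists_antitone_isArcHull` of `HullApproximation`:

* G. F. Lawler, O. Schramm, W. Werner, *Conformal restriction: the chordal case*, J. Amer. Math.
  Soc. **16** (2003) 917–955, arXiv:math/0209343 (**[LSW]**, arXiv page numbers), Lemma 2.1
  (p. 8: "Suppose `A ∈ 𝒬₊`. Then there exists a decreasing sequence of smooth hulls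
  `(A_n)_{n ≥ 1}` such that `A = ⋂ A_n` and the increasing sequence `Φ'_{A_n}(0)` converges to
  `Φ'_A(0)`. The existence of the sequence `A_n` can be obtained by various means, for example, by
  considering the image under `Φ_A⁻¹` of appropriately chosen paths. The monotonicity of
  `Φ'_{A_n}(0)` follows immediately from the monotonicity of `A_n` and (2.4). The convergence is
  immediate by elementary properties of conformal maps, since `Φ_{A_n}` converges locally uniformly
  to `Φ_A` on `ℍ ∖ A`") together with the convergence notion of Lemma 3.5 (p. 12) realised in its
  proof (p. 13) by `E_δ = cl(A ∪ Φ_A⁻¹(D_δ))`, `D_δ` the `δ`-neighbourhood in `ℍ` of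
  `[Φ_A(x₀), Φ_A(x₁)]`.

## The proof (`IsPlusHull.exists_antitone_isArcHull_holds`)

For nonempty `A ∈ 𝒬₊` let `Φ_A = hA.baseMap` with its Schwarz reflection `E_A` on
`Ω_A = ℂ ∖ (A ∪ Ā ∪ [x₀, x₁])`, `E_A(Ω_A) = ℂ ∖ [a, b]`, `a = Φ_A(x₀) < b = Φ_A(x₁)`
(`PlusHullExtension`). The "appropriately chosen paths" are the upper halves of the confocal
ellipses `N_n = ellRegion a b ρ_n` with foci `a, b` and radii `ρ_n = 1 - (1 - ρ_*)/(n+2) ↑ 1`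
(`EllipseHulls`; `ρ_*` chosen so that the half-ellipse hulls `B_n = N_n ∩ ℍ̄` miss `0`), and

  `J_n := B_n · A = hullProduct B_n A Φ_A` (`RestrictionSemigroup`), `ℍ ∖ J_n = Φ_A⁻¹(ℍ ∖ B_n)`.

1. `J_n ∈ 𝒬*` (`IsStarHull.hullProduct`), and `J_n ∈ 𝒬₊` (`pos_of_ofReal_mem_arcHull`: at a real
   `x ≤ 0`, `E_A(x) ≤ E_A(0) = 0` lies left of `N_n`, and `E_A` is continuous at `x`).
2. `J_n` is a smooth hull (`isArcHull_arcHull`): points of `A ∩ ℍ` are interior to `J_n` by the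
   boundary behaviour of `Φ_A` at `A` (`exists_infDist_baseMap_lt`: nearby points of `ℍ ∖ A` are
   mapped into the neighbourhood `N_n` of `[a, b]`); on `ℍ ∖ A` the homeomorphism `Φ_A` gives
   `z ∈ ∂J_n ↔ Φ_A(z) ∈ ∂N_n`; so `ℍ ∩ ∂J_n = E_A⁻¹(ℍ ∩ ∂N_n)` is the interior of the Jordan arc
   `γ_n = E_A⁻¹ ∘ β_n`, `β_n` the upper boundary arc of `N_n`, whose endpoints are the distinct real
   points `E_A⁻¹(c ∓ h(ρ_n + ρ_n⁻¹))`.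
3. `J_n ↓` (`N_n ↓`) and `⋂ J_n = A' = A ∪ [x₀, x₁]` (`iInter_arcHull`): a gap point of
   `[x₀, x₁] ∖ A` is a limit of points of `ℍ ∖ A` mapped into `N_n`; a point `z ∈ ℍ ∖ A` has
   `Φ_A(z) ∈ ℍ` outside `N_n` for large `n`; a real `x ∉ A'` has `E_A(x) ∉ [a, b]` outside `N_n`
   for large `n`.
4. Every restriction map of `J_n` equals `Φ_{B_n} ∘ Φ_A` on `ℍ ∖ J_n` (uniqueness for `+`-hulls,
   `HullUniformizer`), where `‖Φ_{B_n}(w) - w‖ ≤ 2h(ρ_n⁻² - 1) → 0`; a set `S ⊆ ℍ` with compact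
   closure missing `A'` misses `J_n` for large `n` (`eventually_disjoint_of_iInter_eq`), whence the
   uniform convergence; and `Φ'_{J_n}(0) = Φ'_{B_n}(0) Φ'_A(0)` (chain rule,
   `HasRestrictionDeriv.hullProduct`) with `Φ'_{B_n}(0) = ellDeriv a b ρ_n ↑ 1`.

Relation to `ArcApproximation` (an independent, parallel development in the tree): that file
proves the PACKAGED approximation `HasArcApprox A` for one-sided hulls directly, with the stadiums
`D_δ` of [LSW] and the intersection `A ∪ [p, q]` for the auxiliary slit `[p, q] ⊋ [x₀, x₁]`; it
does not address the named fact. The present file discharges the named fact itself — intersection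
exactly the real filling `A' = A ∪ [x₀, x₁]`, hulls in `𝒬₊`, and the monotone convergence
`Φ'_{J_n}(0) ↑ Φ'_A(0)` for arbitrary restriction maps — via the Schwarz reflection `E_A` on the
full symmetric domain (`PlusHullExtension`) and explicit half-ellipse hulls (`EllipseHulls`).
-/

noncomputable section

open Set Filter Topology Metric Bornology Complex
open UpperHalfPlane (upperHalfPlaneSet isOpen_upperHalfPlaneSet)
open scoped ComplexConjugate Real

namespace Literature.Probability.RandomPlanarGeometry

/-! ### Generalities on product hulls -/

section ProductHulls

variable {B B' A : Set ℂ} {Φ : ConformalEquiv (upperHalfPlaneSet \ A) upperHalfPlaneSet}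

/-- The product hull is monotone in its first factor. [folklore] -/
theorem hullProduct_mono_left (h : B ⊆ B') : hullProduct B A Φ ⊆ hullProduct B' A Φ := by
  refine closure_mono ?_
  rintro z (hz | ⟨hz, hzB⟩)
  · exact Or.inl hz
  · exact Or.inr ⟨hz, h hzB⟩

/-- A hull is contained in all its products `B · A`. [folklore] -/
theorem subset_hullProduct (hA : IsBoundedHull A) : A ⊆ hullProduct B A Φ := by
  intro z hz
  rw [← hA.closure_inter_eq] at hz
  exact closure_mono (fun w hw ↦ Or.inl hw) hz

/-- For `z ∈ ℍ`: `z ∈ B · A ↔ z ∈ A ∨ Φ z ∈ B` (closed `A`, `B`). [folklore] -/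
theorem mem_hullProduct_iff_of_mem (hB : IsClosed B) (hA : IsClosed A) {z : ℂ} (hz : z ∈ upperHalfPlaneSet) :
    z ∈ hullProduct B A Φ ↔ z ∈ A ∨ Φ z ∈ B := by
  have h := notMem_hullProduct_iff (Φ' := Φ) hB hA hz
  constructor
  · intro hzJ
    by_contra hno
    push Not at hno
    exact (h.2 hno) hzJ
  · intro hor
    by_contra hzJ
    obtain ⟨h1, h2⟩ := h.1 hzJ
    exact hor.elim h1 h2

end ProductHulls

/-! ### The parameters: radii `ρ_n ↑ 1` -/

section Params

variable {A : Set ℂ} (hA : IsPlusHull A) (hne : A.Nonempty)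
include hA hne

/-- There is a radius `ρ ∈ (0, 1)` whose half-ellipse hull around `[a, b]` misses `0`
(`h(ρ + ρ⁻¹) < c`, since `ρ + ρ⁻¹ → 2` and `c - 2h = a > 0`). [folklore] -/
theorem IsPlusHull.exists_radius : ∃ ρ : ℝ, 0 < ρ ∧ ρ < 1 ∧
    ellH (hA.leftVal hne) (hA.rightVal hne) * jLevel ρ < ellC (hA.leftVal hne) (hA.rightVal hne) := by
  have hh := ellH_pos (hA.leftVal_lt_rightVal hne)
  have ha : 0 < hA.leftVal hne := hA.leftVal_pos hne
  have hlt : ellH (hA.leftVal hne) (hA.rightVal hne) * 2 < ellC (hA.leftVal hne) (hA.rightVal hne) := by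
    have := left_eq_ellC_sub (hA.leftVal hne) (hA.rightVal hne)
    linarith
  have hlt' : (2 : ℝ) < ellC (hA.leftVal hne) (hA.rightVal hne) / ellH (hA.leftVal hne) (hA.rightVal hne) := by
    rwa [lt_div_iff₀ hh, mul_comm]
  have hev : ∀ᶠ ρ in 𝓝 (1 : ℝ), jLevel ρ < ellC (hA.leftVal hne) (hA.rightVal hne) / ellH (hA.leftVal hne) (hA.rightVal hne) :=
    tendsto_jLevel_one (Iio_mem_nhds hlt')
  have hev1 : ∀ᶠ ρ in 𝓝[<] (1 : ℝ), jLevel ρ < ellC (hA.leftVal hne) (hA.rightVal hne) / ellH (hA.leftVal hne) (hA.rightVal hne) :=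
    nhdsWithin_le_nhds hev
  have hev2 : ∀ᶠ ρ in 𝓝[<] (1 : ℝ), 0 < ρ := nhdsWithin_le_nhds (Ioi_mem_nhds one_pos)
  have hev3 : ∀ᶠ ρ in 𝓝[<] (1 : ℝ), ρ < 1 := self_mem_nhdsWithin
  obtain ⟨ρ, h1, h2, h3⟩ := (hev1.and (hev2.and hev3)).exists
  refine ⟨ρ, h2, h3, ?_⟩
  rwa [lt_div_iff₀ hh, mul_comm] at h1

/-- A fixed admissible radius `ρ_* ∈ (0, 1)`. [folklore] -/
def IsPlusHull.rho0 : ℝ := Classical.choose (hA.exists_radius hne)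

/-- The defining properties of `ρ_*`. [folklore] -/
theorem IsPlusHull.rho0_spec : 0 < hA.rho0 hne ∧ hA.rho0 hne < 1 ∧
    ellH (hA.leftVal hne) (hA.rightVal hne) * jLevel (hA.rho0 hne) < ellC (hA.leftVal hne) (hA.rightVal hne) :=
  Classical.choose_spec (hA.exists_radius hne)

/-- **The radii `ρ_n = 1 - (1 - ρ_*)/(n + 2) ↑ 1`.** [folklore] -/
def IsPlusHull.rho (n : ℕ) : ℝ := 1 - (1 - hA.rho0 hne) / (n + 2)

/-- `ρ_* ≤ ρ_n`. [folklore] -/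
theorem IsPlusHull.rho0_le_rho (n : ℕ) : hA.rho0 hne ≤ hA.rho hne n := by
  obtain ⟨h0, h1, -⟩ := hA.rho0_spec hne
  rw [IsPlusHull.rho, le_sub_iff_add_le]
  have hn : (2 : ℝ) ≤ n + 2 := by have := n.cast_nonneg (α := ℝ); linarith
  have : (1 - hA.rho0 hne) / (n + 2) ≤ (1 - hA.rho0 hne) / 2 :=
    div_le_div_of_nonneg_left (by linarith) (by norm_num) hn
  linarith

/-- `0 < ρ_n`. [folklore] -/
theorem IsPlusHull.rho_pos (n : ℕ) : 0 < hA.rho hne n := (hA.rho0_spec hne).1.trans_le (hA.rho0_le_rho hne n)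

/-- `ρ_n < 1`. [folklore] -/
theorem IsPlusHull.rho_lt_one (n : ℕ) : hA.rho hne n < 1 := by
  obtain ⟨h0, h1, -⟩ := hA.rho0_spec hne
  rw [IsPlusHull.rho, sub_lt_self_iff]
  positivity

/-- `ρ_n` is increasing. [folklore] -/
theorem IsPlusHull.rho_mono : Monotone (hA.rho hne) := by
  intro m n hmn
  obtain ⟨h0, h1, -⟩ := hA.rho0_spec hne
  rw [IsPlusHull.rho, IsPlusHull.rho, sub_le_sub_iff_left]
  exact div_le_div_of_nonneg_left (by linarith) (by positivity) (by exact_mod_cast Nat.add_le_add_right hmn 2)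

/-- `ρ_n → 1`. [folklore] -/
theorem IsPlusHull.tendsto_rho : Tendsto (hA.rho hne) atTop (𝓝 1) := by
  have h1 : Tendsto (fun n : ℕ ↦ (1 - hA.rho0 hne) / ((n : ℝ) + 2)) atTop (𝓝 0) := by
    have := tendsto_natCast_atTop_atTop (R := ℝ)
    have h2 : Tendsto (fun n : ℕ ↦ (n : ℝ) + 2) atTop atTop := tendsto_atTop_add_const_right _ _ this
    exact h2.const_div_atTop _ |>.congr fun n ↦ rfl
  have := h1.const_sub 1
  rw [sub_zero] at this
  exact this

/-- `ρ_n → 1` from below. [folklore] -/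
theorem IsPlusHull.tendsto_rho_nhdsLT : Tendsto (hA.rho hne) atTop (𝓝[<] 1) :=
  tendsto_nhdsWithin_iff.2 ⟨hA.tendsto_rho hne, Eventually.of_forall fun n ↦ hA.rho_lt_one hne n⟩

/-- The admissibility condition holds for every `ρ_n`. [folklore] -/
theorem IsPlusHull.rho_cond (n : ℕ) :
    ellH (hA.leftVal hne) (hA.rightVal hne) * jLevel (hA.rho hne n) < ellC (hA.leftVal hne) (hA.rightVal hne) := by
  obtain ⟨h0, h1, hc⟩ := hA.rho0_spec hne
  have hle : jLevel (hA.rho hne n) ≤ jLevel (hA.rho0 hne) :=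
    jLevel_le_jLevel h0 (hA.rho0_le_rho hne n) (hA.rho_lt_one hne n).le
  have hh := ellH_pos (hA.leftVal_lt_rightVal hne)
  nlinarith

end Params

/-! ### The smooth hulls `J_n = B_n · A` -/

section Hulls

variable {A : Set ℂ} (hA : IsPlusHull A) (hne : A.Nonempty)
include hA hne

/-- The half-ellipse hull `B_n = B(a, b; ρ_n)`. [folklore] -/
def IsPlusHull.ellB (n : ℕ) : Set ℂ := ellHull (hA.leftVal hne) (hA.rightVal hne) (hA.rho hne n)

/-- The full ellipse `N_n = N(a, b; ρ_n)`. [folklore] -/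
def IsPlusHull.ellN (n : ℕ) : Set ℂ := ellRegion (hA.leftVal hne) (hA.rightVal hne) (hA.rho hne n)

/-- `B_n` is a `*`-hull. [folklore] -/
theorem IsPlusHull.isStarHull_ellB (n : ℕ) : IsStarHull (hA.ellB hne n) :=
  isStarHull_ellHull (hA.leftVal_lt_rightVal hne) (hA.rho_pos hne n) (hA.rho_lt_one hne n) (hA.rho_cond hne n)

/-- The restriction map `Φ_{B_n}`. [folklore] -/
def IsPlusHull.ellBMap (n : ℕ) : ConformalEquiv (upperHalfPlaneSet \ hA.ellB hne n) upperHalfPlaneSet :=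
  ellConf (hA.leftVal_lt_rightVal hne) (hA.rho_pos hne n) (hA.rho_lt_one hne n).le (hA.rho_cond hne n)

/-- `Φ_{B_n}` is a restriction map. [folklore] -/
theorem IsPlusHull.isRestrictionMap_ellBMap (n : ℕ) : IsRestrictionMap (hA.ellB hne n) (hA.ellBMap hne n) :=
  isRestrictionMap_ellConf (hA.leftVal_lt_rightVal hne) (hA.rho_pos hne n) (hA.rho_lt_one hne n) (hA.rho_cond hne n)

/-- **The smooth hulls `J_n := B_n · A`** (`hullProduct`): `ℍ ∖ J_n = Φ_A⁻¹(ℍ ∖ B_n)`, i.e.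
`J_n ∩ ℍ = (A ∩ ℍ) ∪ Φ_A⁻¹(B_n)` — the hulls `E_δ` of [LSW] p. 13 with `D_δ` replaced by the
half-ellipse `B_n` with foci `Φ_A(x₀), Φ_A(x₁)`. [cite: LawlerSchrammWerner2003Restriction, proof of Lemma 3.5 (p. 13, E_δ)] -/
def IsPlusHull.arcHull (n : ℕ) : Set ℂ := hullProduct (hA.ellB hne n) A (hA.baseMap hne)

/-- `J_n` is a `*`-hull. [folklore] -/
theorem IsPlusHull.isStarHull_arcHull (n : ℕ) : IsStarHull (hA.arcHull hne n) :=
  (hA.isStarHull_ellB hne n).hullProduct hA.1 (hA.isRestrictionMap_baseMap hne)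

/-- `A ⊆ J_n`. [folklore] -/
theorem IsPlusHull.subset_arcHull (n : ℕ) : A ⊆ hA.arcHull hne n := subset_hullProduct hA.1.isBoundedHull

/-- `J_n` is nonempty. [folklore] -/
theorem IsPlusHull.arcHull_nonempty (n : ℕ) : (hA.arcHull hne n).Nonempty := hne.mono (hA.subset_arcHull hne n)

/-- For `z ∈ ℍ`: `z ∈ J_n ↔ z ∈ A ∨ Φ_A z ∈ N_n`. [folklore] -/
theorem IsPlusHull.mem_arcHull_iff (n : ℕ) {z : ℂ} (hz : 0 < z.im) :
    z ∈ hA.arcHull hne n ↔ z ∈ A ∨ (z ∉ A ∧ hA.baseMap hne z ∈ hA.ellN hne n) := by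
  have key := mem_hullProduct_iff_of_mem (B := hA.ellB hne n) (Φ := hA.baseMap hne) (isClosed_ellHull _ _ _)
    hA.1.isBoundedHull.isClosed hz
  rw [IsPlusHull.arcHull, key]
  constructor
  · rintro (h | h)
    · exact Or.inl h
    · by_cases hzA : z ∈ A
      · exact Or.inl hzA
      · exact Or.inr ⟨hzA, h.1⟩
  · rintro (h | ⟨hzA, h⟩)
    · exact Or.inl h
    · exact Or.inr ⟨h, le_of_lt (show 0 < (hA.baseMap hne z).im from (hA.baseMap hne).mapsTo ⟨hz, hzA⟩)⟩

/-- **The `J_n` decrease.** [folklore] -/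
theorem IsPlusHull.antitone_arcHull : Antitone (hA.arcHull hne) := fun m n hmn ↦
  hullProduct_mono_left (ellHull_mono (hA.rho_pos hne m) (hA.rho_mono hne hmn) (hA.rho_lt_one hne n).le)

/-- **The real points of `J_n` are positive**: at a real `x ≤ 0`, `E_A` is continuous with
`E_A(x) ≤ E_A(0) = 0 < c - h(ρ_n + ρ_n⁻¹) ≤ re w` for all `w ∈ N_n`, so a neighbourhood of `x`
misses `J_n ∩ ℍ`. [folklore] -/
theorem IsPlusHull.pos_of_ofReal_mem_arcHull (n : ℕ) {x : ℝ} (hx : (x : ℂ) ∈ hA.arcHull hne n) : 0 < x := by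
  by_contra hx0
  push Not at hx0
  have hxlt : x < leftPt A := lt_of_le_of_lt hx0 (hA.leftPt_pos hne)
  have hxΩ : (x : ℂ) ∈ plusDomain A := hA.ofReal_mem_plusDomain_of_lt hne hxlt
  set ℓ : ℝ := ellC (hA.leftVal hne) (hA.rightVal hne) - ellH (hA.leftVal hne) (hA.rightVal hne) * jLevel (hA.rho hne n)
  have hℓ : 0 < ℓ := by have := hA.rho_cond hne n; simp only [ℓ]; linarith
  have hEx : (hA.extMap hne x).re ≤ 0 := by
    show hA.realExt hne x ≤ 0
    rw [← hA.realExt_zero hne]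
    exact (hA.strictMonoOn_realExt_Iio hne).monotoneOn hxlt (hA.leftPt_pos hne) hx0
  -- the open neighbourhood `U = Ω_A ∩ E_A⁻¹ {re < ℓ}` of `x` misses `J_n ∩ ℍ`
  set U : Set ℂ := plusDomain A ∩ hA.extMap hne ⁻¹' {w | w.re < ℓ} with hU
  have hUo : IsOpen U := (hA.continuousOn_extMap hne).isOpen_inter_preimage hA.isOpen_plusDomain
    (isOpen_lt continuous_re continuous_const)
  have hxU : (x : ℂ) ∈ U := ⟨hxΩ, by show (hA.extMap hne x).re < ℓ; linarith⟩
  have hdisj : U ∩ hullProductCore (hA.ellB hne n) A (hA.baseMap hne) = ∅ := by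
    ext w
    simp only [mem_inter_iff, mem_empty_iff_false, iff_false, not_and]
    rintro ⟨hwΩ, hwℓ⟩ hcore
    have hwH : w ∈ upperHalfPlaneSet := hullProductCore_subset hcore
    have hwA : w ∉ A := (hA.mem_plusDomain_iff_of_im_pos hwH).1 hwΩ
    rcases hcore with ⟨hwA', -⟩ | ⟨-, hwB⟩
    · exact hwA hwA'
    · have h1 := (re_bounds_of_mem_ellRegion (hA.leftVal_lt_rightVal hne) hwB.1).1
      rw [← hA.extMap_of_mem_diff hne ⟨hwH, hwA⟩] at h1
      exact absurd hwℓ (not_lt.2 h1)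
  have : (x : ℂ) ∉ closure (hullProductCore (hA.ellB hne n) A (hA.baseMap hne)) := by
    rw [_root_.mem_closure_iff]
    push Not
    exact ⟨U, hUo, hxU, hdisj⟩
  exact this hx

/-- **`J_n ∈ 𝒬₊`.** [folklore] -/
theorem IsPlusHull.isPlusHull_arcHull (n : ℕ) : IsPlusHull (hA.arcHull hne n) :=
  ⟨hA.isStarHull_arcHull hne n, fun _ hx ↦ hA.pos_of_ofReal_mem_arcHull hne n hx⟩

end Hulls

/-! ### `J_n` is a smooth hull: `ℍ ∩ ∂J_n = Φ_A⁻¹(ℍ ∩ ∂N_n)` is a Jordan arc -/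

section Arc

variable {A : Set ℂ} (hA : IsPlusHull A) (hne : A.Nonempty)
include hA hne

/-- **`N_n` is a neighbourhood of `[a, b]` of size `ε_n = h(ρ_n + ρ_n⁻¹ - 2) > 0`.** [folklore] -/
theorem IsPlusHull.ellN_thick (n : ℕ) : ∃ ε > 0, ∀ w : ℂ, infDist w (hA.valSeg hne) < ε → w ∈ hA.ellN hne n := by
  refine ⟨ellH (hA.leftVal hne) (hA.rightVal hne) * (jLevel (hA.rho hne n) - 2),
    mul_pos (ellH_pos (hA.leftVal_lt_rightVal hne)) (by linarith [two_lt_jLevel (hA.rho_pos hne n) (hA.rho_lt_one hne n)]),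
    fun w hw ↦ mem_ellRegion_of_infDist_lt (hA.leftVal_lt_rightVal hne) le_rfl hw⟩

/-- **Points of `A ∩ ℍ` are interior to `J_n`** (boundary behaviour of `Φ_A` at `A`: nearby points of
`ℍ ∖ A` are mapped close to `[a, b]`, into `N_n`). [folklore] -/
theorem IsPlusHull.mem_interior_arcHull (n : ℕ) {z : ℂ} (hzA : z ∈ A) (hz : 0 < z.im) :
    z ∈ interior (hA.arcHull hne n) := by
  obtain ⟨ε, hε, hN⟩ := hA.ellN_thick hne n
  obtain ⟨r, hr, hclose⟩ := hA.exists_infDist_baseMap_lt hne (subset_realFill A hzA) hε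
  rw [mem_interior_iff_mem_nhds, Metric.mem_nhds_iff]
  refine ⟨min r z.im, lt_min hr hz, fun w hw ↦ ?_⟩
  rw [mem_ball] at hw
  have hwim : 0 < w.im := by
    have h1 : |w.im - z.im| ≤ dist w z := by
      rw [dist_eq_norm, ← sub_im]
      exact abs_im_le_norm _
    have h2 : dist w z < z.im := lt_of_lt_of_le hw (min_le_right _ _)
    have := neg_abs_le (w.im - z.im)
    linarith
  rw [hA.mem_arcHull_iff hne n hwim]
  by_cases hwA : w ∈ A
  · exact Or.inl hwA
  · exact Or.inr ⟨hwA, hN _ (hclose w ⟨hwim, hwA⟩ (lt_of_lt_of_le hw (min_le_left _ _)))⟩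

/-- **For `z ∈ ℍ ∖ A`: `z` is interior to `J_n` iff `Φ_A(z)` is interior to `N_n`** (`Φ_A` is a
homeomorphism `ℍ ∖ A → ℍ`). [folklore] -/
theorem IsPlusHull.mem_interior_arcHull_iff (n : ℕ) {z : ℂ} (hz : z ∈ upperHalfPlaneSet \ A) :
    z ∈ interior (hA.arcHull hne n) ↔ hA.baseMap hne z ∈ interior (hA.ellN hne n) := by
  set Φ := hA.baseMap hne with hΦ
  have hUo : IsOpen (upperHalfPlaneSet \ A) := isOpen_upperHalfPlaneSet.sdiff hA.1.isBoundedHull.isClosed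
  constructor
  · intro hint
    -- `V = int J_n ∩ (ℍ ∖ A)`, `Φ(V)` is open and inside `N_n`
    set V : Set ℂ := interior (hA.arcHull hne n) ∩ (upperHalfPlaneSet \ A) with hV
    have hVo : IsOpen V := isOpen_interior.inter hUo
    have himg : Φ '' V = {w ∈ upperHalfPlaneSet | Φ.symm w ∈ V} := by
      ext w
      constructor
      · rintro ⟨v, hv, rfl⟩
        exact ⟨Φ.mapsTo hv.2, by rw [Φ.symm_apply_apply hv.2]; exact hv⟩
      · rintro ⟨hw, hwV⟩
        exact ⟨Φ.symm w, hwV, Φ.apply_symm_apply hw⟩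
    have himgo : IsOpen (Φ '' V) := by
      rw [himg]
      exact Φ.symm.continuousOn.isOpen_inter_preimage isOpen_upperHalfPlaneSet hVo
    have hsub : Φ '' V ⊆ hA.ellN hne n := by
      rintro _ ⟨v, ⟨hvint, hvU⟩, rfl⟩
      have hvJ : v ∈ hA.arcHull hne n := interior_subset hvint
      rcases (hA.mem_arcHull_iff hne n hvU.1).1 hvJ with h | ⟨-, h⟩
      · exact absurd h hvU.2
      · exact h
    exact interior_maximal hsub himgo ⟨z, ⟨hint, hz⟩, rfl⟩
  · intro hint
    set V' : Set ℂ := (upperHalfPlaneSet \ A) ∩ Φ ⁻¹' interior (hA.ellN hne n) with hV'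
    have hV'o : IsOpen V' := Φ.continuousOn.isOpen_inter_preimage hUo isOpen_interior
    have hsub : V' ⊆ hA.arcHull hne n := by
      rintro w ⟨hwU, hwN⟩
      exact (hA.mem_arcHull_iff hne n hwU.1).2 (Or.inr ⟨hwU.2, interior_subset hwN⟩)
    exact interior_maximal hsub hV'o ⟨hz, hint⟩

/-- **For `z ∈ ℍ`: `z ∈ ∂J_n ↔ z ∉ A ∧ Φ_A(z) ∈ ∂N_n`.** [folklore] -/
theorem IsPlusHull.mem_frontier_arcHull_iff (n : ℕ) {z : ℂ} (hz : 0 < z.im) :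
    z ∈ frontier (hA.arcHull hne n) ↔ z ∉ A ∧ hA.baseMap hne z ∈ frontier (hA.ellN hne n) := by
  have hJc : IsClosed (hA.arcHull hne n) := isClosed_hullProduct
  have hNc : IsClosed (hA.ellN hne n) := isClosed_ellRegion _ _ _
  rw [hJc.frontier_eq, hNc.frontier_eq]
  by_cases hzA : z ∈ A
  · constructor
    · rintro ⟨-, hnint⟩
      exact absurd (hA.mem_interior_arcHull hne n hzA hz) hnint
    · rintro ⟨h, -⟩
      exact absurd hzA h
  · rw [Set.mem_sdiff, Set.mem_sdiff, hA.mem_interior_arcHull_iff hne n ⟨hz, hzA⟩, hA.mem_arcHull_iff hne n hz]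
    constructor
    · rintro ⟨hmem | ⟨-, hmem⟩, hnint⟩
      · exact absurd hmem hzA
      · exact ⟨hzA, hmem, hnint⟩
    · rintro ⟨-, hmem, hnint⟩
      exact ⟨Or.inr ⟨hzA, hmem⟩, hnint⟩

/-- **The boundary arc `γ_n = E_A⁻¹ ∘ β_n` of `J_n`**, `β_n` the upper boundary arc of `N_n`
("`∂E_δ ∩ ℍ̄` is a simple path `β` with `β(0), β(s) ∈ ℝ`", [LSW] p. 13). [cite: LawlerSchrammWerner2003Restriction, proof of Lemma 3.5 (p. 13)] -/
def IsPlusHull.arcHullArc (n : ℕ) (t : ℝ) : ℂ :=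
  hA.invExt hne (ellHullArc (hA.leftVal hne) (hA.rightVal hne) (hA.rho hne n) t)

/-- The points of `β_n[0, 1]` lie off `[a, b]`. [folklore] -/
theorem IsPlusHull.ellHullArc_notMem_valSeg (n : ℕ) {t : ℝ} (ht : t ∈ Icc (0 : ℝ) 1) :
    ellHullArc (hA.leftVal hne) (hA.rightVal hne) (hA.rho hne n) t ∉ hA.valSeg hne := by
  have hend := ellHullArc_endpoints (hA.leftVal_lt_rightVal hne) (hA.rho_pos hne n) (hA.rho_lt_one hne n)
  rcases eq_or_lt_of_le ht.1 with h0 | h0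
  · rw [← h0, ellHullArc_zero _ _ (hA.rho_pos hne n), hA.mem_valSeg_iff hne]
    rintro ⟨-, -, h⟩
    rw [ofReal_re] at h
    linarith [hend.2, hA.leftVal_le_rightVal hne]
  · rcases eq_or_lt_of_le ht.2 with h1 | h1
    · rw [h1, ellHullArc_one _ _ (hA.rho_pos hne n), hA.mem_valSeg_iff hne]
      rintro ⟨-, h, -⟩
      rw [ofReal_re] at h
      linarith [hend.1]
    · exact hA.notMem_valSeg_of_im_pos hne
        (ellHullArc_im_pos (hA.leftVal_lt_rightVal hne) (hA.rho_pos hne n) (hA.rho_lt_one hne n) ⟨h0, h1⟩)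


/-- **`ℍ ∩ ∂J_n = γ_n(0, 1)`.** [folklore] -/
theorem IsPlusHull.upperHalfPlaneSet_inter_frontier_arcHull (n : ℕ) :
    upperHalfPlaneSet ∩ frontier (hA.arcHull hne n) = hA.arcHullArc hne n '' Ioo 0 1 := by
  have hfrN := upperHalfPlaneSet_inter_frontier_ellRegion (hA.leftVal_lt_rightVal hne) (hA.rho_pos hne n) (hA.rho_lt_one hne n)
  ext z
  constructor
  · rintro ⟨hz, hfr⟩
    obtain ⟨hzA, hΦ⟩ := (hA.mem_frontier_arcHull_iff hne n hz).1 hfr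
    have hΦH : hA.baseMap hne z ∈ upperHalfPlaneSet := (hA.baseMap hne).mapsTo ⟨hz, hzA⟩
    have : hA.baseMap hne z ∈ upperHalfPlaneSet ∩ frontier (hA.ellN hne n) := ⟨hΦH, hΦ⟩
    rw [IsPlusHull.ellN, hfrN] at this
    obtain ⟨t, ht, hteq⟩ := this
    refine ⟨t, ht, ?_⟩
    rw [IsPlusHull.arcHullArc, hteq, ← hA.extMap_of_mem_diff hne ⟨hz, hzA⟩,
      hA.invExt_extMap hne (hA.diff_subset_plusDomain ⟨hz, hzA⟩)]
  · rintro ⟨t, ht, rfl⟩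
    have hβ : ellHullArc (hA.leftVal hne) (hA.rightVal hne) (hA.rho hne n) t ∈
        upperHalfPlaneSet ∩ frontier (hA.ellN hne n) := by
      rw [IsPlusHull.ellN, hfrN]
      exact ⟨t, ht, rfl⟩
    have hzU : hA.arcHullArc hne n t ∈ upperHalfPlaneSet \ A := hA.invExt_mem_diff hne hβ.1
    refine ⟨hzU.1, (hA.mem_frontier_arcHull_iff hne n hzU.1).2 ⟨hzU.2, ?_⟩⟩
    rw [← hA.extMap_of_mem_diff hne hzU, IsPlusHull.arcHullArc,
      hA.extMap_invExt hne (hA.notMem_valSeg_of_im_pos hne hβ.1)]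
    exact hβ.2

/-- **`J_n` is a smooth hull** (`IsArcHull`): `ℍ ∩ ∂J_n` is the interior of the Jordan arc
`γ_n = E_A⁻¹ ∘ β_n` with the distinct real endpoints `E_A⁻¹(c ± h(ρ_n + ρ_n⁻¹))`. [cite: LawlerSchrammWerner2003Restriction, proof of Lemma 3.5 (p. 13, ∂E_δ ∩ ℍ̄ is a simple path)] -/
theorem IsPlusHull.isArcHull_arcHull (n : ℕ) : IsArcHull (hA.arcHull hne n) := by
  have h0 := hA.rho_pos hne n
  have h1 := hA.rho_lt_one hne n
  have hend := ellHullArc_endpoints (hA.leftVal_lt_rightVal hne) h0 h1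
  refine ⟨(hA.isStarHull_arcHull hne n).isBoundedHull, hA.arcHullArc hne n, ?_, ?_, ?_, ?_, ?_,
    hA.upperHalfPlaneSet_inter_frontier_arcHull hne n⟩
  · -- continuity on `[0, 1]`: `β_n[0,1] ⊆ ℂ ∖ [a, b]`, where `E_A⁻¹` is continuous
    refine (hA.continuousOn_invExt hne).comp (continuous_ellHullArc _ _ h0).continuousOn fun t ht ↦ ?_
    exact hA.ellHullArc_notMem_valSeg hne n ht
  · -- injectivity
    intro s hs t ht hst
    exact injOn_ellHullArc (hA.leftVal_lt_rightVal hne) h0 hs ht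
      (hA.injOn_invExt hne (hA.ellHullArc_notMem_valSeg hne n hs) (hA.ellHullArc_notMem_valSeg hne n ht) hst)
  · -- `γ_n(0)` is real
    rw [IsPlusHull.arcHullArc, hA.invExt_im_eq_zero_iff hne (hA.ellHullArc_notMem_valSeg hne n ⟨le_rfl, zero_le_one⟩)]
    exact ellHullArc_im_eq_zero _ _ h0 (Or.inl rfl)
  · rw [IsPlusHull.arcHullArc, hA.invExt_im_eq_zero_iff hne (hA.ellHullArc_notMem_valSeg hne n ⟨zero_le_one, le_rfl⟩)]
    exact ellHullArc_im_eq_zero _ _ h0 (Or.inr rfl)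
  · intro t ht
    rw [IsPlusHull.arcHullArc, hA.invExt_im_pos_iff hne (hA.ellHullArc_notMem_valSeg hne n ⟨ht.1.le, ht.2.le⟩)]
    exact ellHullArc_im_pos (hA.leftVal_lt_rightVal hne) h0 h1 ht

end Arc

/-! ### `⋂ₙ J_n = A' = A ∪ [x₀, x₁]` -/

section Inter

variable {A : Set ℂ} (hA : IsPlusHull A) (hne : A.Nonempty)
include hA hne

/-- **`A' ⊆ J_n`**: a real gap point `x ∈ [x₀, x₁] ∖ A` is a limit of points of `ℍ ∖ A`, which
near `x` are mapped by `Φ_A` close to `[a, b]`, into `N_n`. [folklore] -/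
theorem IsPlusHull.realFill_subset_arcHull (n : ℕ) : realFill A ⊆ hA.arcHull hne n := by
  intro z hz
  by_cases hzA : z ∈ A
  · exact hA.subset_arcHull hne n hzA
  -- `z = x ∈ [x₀, x₁] ∖ A`
  rcases hz with hz | ⟨x, hx, rfl⟩
  · exact absurd hz hzA
  obtain ⟨ε, hε, hN⟩ := hA.ellN_thick hne n
  obtain ⟨r, hr, hclose⟩ := hA.exists_infDist_baseMap_lt hne (Or.inr ⟨x, hx, rfl⟩ : (x : ℂ) ∈ realFill A) hε
  have hcl : (x : ℂ) ∈ closure ((upperHalfPlaneSet \ A) ∩ ball (x : ℂ) r) := by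
    have h1 := ofReal_mem_closure_diff hA.1.isBoundedHull.isClosed hzA
    rw [inter_comm]
    exact isOpen_ball.inter_closure ⟨mem_ball_self hr, h1⟩
  refine closure_mono ?_ hcl
  rintro w ⟨hwU, hwr⟩
  refine Or.inr ⟨hwU, ⟨hN _ (hclose w hwU (mem_ball.1 hwr)), ?_⟩⟩
  exact le_of_lt (show 0 < (hA.baseMap hne w).im from (hA.baseMap hne).mapsTo hwU)

/-- `J_n` lies in the closed upper half-plane. [folklore] -/
theorem IsPlusHull.im_nonneg_of_mem_arcHull (n : ℕ) {z : ℂ} (hz : z ∈ hA.arcHull hne n) : 0 ≤ z.im := by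
  have := (hA.isStarHull_arcHull hne n).isBoundedHull.subset_closure hz
  rwa [show upperHalfPlaneSet = {z : ℂ | 0 < z.im} from rfl, closure_setOf_lt_im] at this

/-- A real point off `A'` is off `J_n` for large `n`: `E_A` is continuous at `x` with the real value
`E_A(x) ∉ [a, b]`, which the shrinking ellipses `N_n` eventually miss. [folklore] -/
theorem IsPlusHull.exists_ofReal_notMem_arcHull {x : ℝ} (hx : (x : ℂ) ∉ realFill A) : ∃ n, (x : ℂ) ∉ hA.arcHull hne n := by
  have hxA : (x : ℂ) ∉ A := fun h ↦ hx (Or.inl h)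
  have hxI : x ∉ Icc (leftPt A) (rightPt A) := fun h ↦ hx (Or.inr ⟨x, h, rfl⟩)
  have hxΩ : (x : ℂ) ∈ plusDomain A := by
    rw [hA.ofReal_mem_plusDomain_iff hne]
    rcases lt_or_ge x (leftPt A) with h | h
    · exact Or.inl h
    · right
      by_contra h'
      push Not at h'
      exact hxI ⟨h, h'⟩
  -- `E_A(x)` is a real number off `[a, b]`; the ellipses eventually miss it
  set u : ℝ := hA.realExt hne x with hu
  have hu_out : u < hA.leftVal hne ∨ hA.rightVal hne < u := by
    rcases (hA.ofReal_mem_plusDomain_iff hne).1 hxΩ with h | h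
    · exact Or.inl (hA.realExt_lt_leftVal hne h)
    · exact Or.inr (hA.rightVal_lt_realExt hne h)
  set a := hA.leftVal hne
  set b := hA.rightVal hne
  have hh := ellH_pos (hA.leftVal_lt_rightVal hne)
  -- `c ∓ h(ρ_n + ρ_n⁻¹) → a, b`
  have hlim : Tendsto (fun n ↦ ellH a b * jLevel (hA.rho hne n)) atTop (𝓝 (ellH a b * 2)) :=
    (tendsto_jLevel_one.comp (hA.tendsto_rho hne)).const_mul _
  have hca : ellC a b - ellH a b * 2 = a := by have := left_eq_ellC_sub a b; linarith
  have hcb : ellC a b + ellH a b * 2 = b := by have := right_eq_ellC_add a b; linarith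
  obtain ⟨n, hn⟩ : ∃ n, (u : ℂ) ∉ hA.ellN hne n := by
    rcases hu_out with hlt | hgt
    · have h2 : Tendsto (fun n ↦ ellC a b - ellH a b * jLevel (hA.rho hne n)) atTop (𝓝 (ellC a b - ellH a b * 2)) :=
        hlim.const_sub _
      rw [hca] at h2
      have hev : ∀ᶠ n in atTop, u < ellC a b - ellH a b * jLevel (hA.rho hne n) := h2 (Ioi_mem_nhds hlt)
      obtain ⟨n, hn⟩ := hev.exists
      exact ⟨n, fun h ↦ by have := (ofReal_mem_ellRegion (hA.leftVal_lt_rightVal hne) h).1; linarith⟩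
    · have h2 : Tendsto (fun n ↦ ellC a b + ellH a b * jLevel (hA.rho hne n)) atTop (𝓝 (ellC a b + ellH a b * 2)) :=
        hlim.const_add _
      rw [hcb] at h2
      have hev : ∀ᶠ n in atTop, ellC a b + ellH a b * jLevel (hA.rho hne n) < u := h2 (Iio_mem_nhds hgt)
      obtain ⟨n, hn⟩ := hev.exists
      exact ⟨n, fun h ↦ by have := (ofReal_mem_ellRegion (hA.leftVal_lt_rightVal hne) h).2; linarith⟩
  refine ⟨n, fun hxJ ↦ ?_⟩
  -- the open neighbourhood `U = Ω_A ∩ E_A⁻¹(ℂ ∖ N_n)` of `x` misses `J_n ∩ ℍ`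
  set U : Set ℂ := plusDomain A ∩ hA.extMap hne ⁻¹' (hA.ellN hne n)ᶜ with hU
  have hUo : IsOpen U := (hA.continuousOn_extMap hne).isOpen_inter_preimage hA.isOpen_plusDomain
    (isClosed_ellRegion _ _ _).isOpen_compl
  have hxU : (x : ℂ) ∈ U := ⟨hxΩ, by show hA.extMap hne x ∉ hA.ellN hne n; rwa [hA.extMap_ofReal hne hxΩ]⟩
  have hdisj : U ∩ hullProductCore (hA.ellB hne n) A (hA.baseMap hne) = ∅ := by
    ext w
    simp only [mem_inter_iff, mem_empty_iff_false, iff_false, not_and]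
    rintro ⟨hwΩ, hwN⟩ hcore
    have hwH : w ∈ upperHalfPlaneSet := hullProductCore_subset hcore
    have hwA : w ∉ A := (hA.mem_plusDomain_iff_of_im_pos hwH).1 hwΩ
    rcases hcore with ⟨hwA', -⟩ | ⟨-, hwB⟩
    · exact hwA hwA'
    · rw [mem_preimage, hA.extMap_of_mem_diff hne ⟨hwH, hwA⟩] at hwN
      exact hwN hwB.1
  have : (x : ℂ) ∉ closure (hullProductCore (hA.ellB hne n) A (hA.baseMap hne)) := by
    rw [_root_.mem_closure_iff]
    push Not
    exact ⟨U, hUo, hxU, hdisj⟩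
  exact this hxJ

/-- **`⋂ₙ J_n = A'`.** [cite: LawlerSchrammWerner2003Restriction, Lemma 2.1 (p. 8, "A = ⋂ A_n") with proof of Lemma 3.5 (p. 13, A')] -/
theorem IsPlusHull.iInter_arcHull : (⋂ n, hA.arcHull hne n) = realFill A := by
  refine Subset.antisymm (fun z hz ↦ ?_) (subset_iInter fun n ↦ hA.realFill_subset_arcHull hne n)
  rw [mem_iInter] at hz
  by_contra hzF
  have hzA : z ∉ A := fun h ↦ hzF (Or.inl h)
  rcases (hA.im_nonneg_of_mem_arcHull hne 0 (hz 0)).lt_or_eq with hpos | hzero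
  · -- `z ∈ ℍ ∖ A`: `Φ_A(z) ∈ ℍ` lies in every `N_n`, impossible
    have hΦ : ∀ n, hA.baseMap hne z ∈ hA.ellN hne n := fun n ↦ by
      rcases (hA.mem_arcHull_iff hne n hpos).1 (hz n) with h | ⟨-, h⟩
      · exact absurd h hzA
      · exact h
    have hζ : 0 < (hA.baseMap hne z).im := (hA.baseMap hne).mapsTo ⟨hpos, hzA⟩
    have hev' : ∀ᶠ n in atTop, hA.baseMap hne z ∉ hA.ellN hne n :=
      (hA.tendsto_rho_nhdsLT hne).eventually (eventually_notMem_ellRegion (hA.leftVal_lt_rightVal hne) hζ)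
    obtain ⟨n, hn⟩ := hev'.exists
    exact hn (hΦ n)
  · -- `z` real off `A'`
    have hzre : ((z.re : ℝ) : ℂ) = z := Complex.ext (by simp) (by simp [hzero])
    rw [← hzre] at hz hzF
    obtain ⟨n, hn⟩ := hA.exists_ofReal_notMem_arcHull hne hzF
    exact hn (hz n)

end Inter

/-! ### Convergence of the restriction maps and of `Φ'_{J_n}(0)` -/

section Convergence

variable {A : Set ℂ} (hA : IsPlusHull A) (hne : A.Nonempty)
include hA hne

/-- **Uniqueness of the restriction maps of `J_n`** (`J_n ∈ 𝒬₊` is nonempty, `HullUniformizer`). [folklore] -/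
theorem IsPlusHull.eqOn_of_isRestrictionMap_arcHull (n : ℕ)
    {Ψ Ψ' : ConformalEquiv (upperHalfPlaneSet \ hA.arcHull hne n) upperHalfPlaneSet}
    (hΨ : IsRestrictionMap (hA.arcHull hne n) Ψ) (hΨ' : IsRestrictionMap (hA.arcHull hne n) Ψ') :
    EqOn Ψ Ψ' (upperHalfPlaneSet \ hA.arcHull hne n) := by
  have h1 := (hA.isPlusHull_arcHull hne n).eqOn_baseMap (hA.arcHull_nonempty hne n) hΨ
  have h2 := (hA.isPlusHull_arcHull hne n).eqOn_baseMap (hA.arcHull_nonempty hne n) hΨ'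
  exact fun z hz ↦ (h1 hz).trans (h2 hz).symm

/-- **The restriction map `Φ_{J_n} = Φ_{B_n} ∘ Φ_A`** of `J_n = B_n · A`. [cite: LawlerSchrammWerner2003Restriction, §2 p. 8 (Φ_{A·A'} = Φ_A ∘ Φ_{A'})] -/
def IsPlusHull.arcHullMap (n : ℕ) : ConformalEquiv (upperHalfPlaneSet \ hA.arcHull hne n) upperHalfPlaneSet :=
  hullProductMap (hA.ellBMap hne n) (hA.baseMap hne) (isClosed_ellHull _ _ _) hA.1.isBoundedHull.isClosed

/-- `Φ_{J_n}(z) = Φ_{B_n}(Φ_A(z))`. [folklore] -/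
theorem IsPlusHull.arcHullMap_apply (n : ℕ) (z : ℂ) :
    hA.arcHullMap hne n z = ellMap (hA.leftVal hne) (hA.rightVal hne) (hA.rho hne n) (hA.baseMap hne z) := rfl

/-- `Φ_{J_n}` is a restriction map of `J_n`. [folklore] -/
theorem IsPlusHull.isRestrictionMap_arcHullMap (n : ℕ) : IsRestrictionMap (hA.arcHull hne n) (hA.arcHullMap hne n) :=
  IsRestrictionMap.hullProduct _ _ (hA.isRestrictionMap_ellBMap hne n) (hA.isRestrictionMap_baseMap hne)

/-- `Φ'_{J_n}(0) = Φ'_{B_n}(0) · Φ'_A(0)`. [folklore] -/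
theorem IsPlusHull.hasRestrictionDeriv_arcHullMap (n : ℕ) :
    HasRestrictionDeriv (hA.arcHull hne n) (hA.arcHullMap hne n)
      (ellDeriv (hA.leftVal hne) (hA.rightVal hne) (hA.rho hne n) * (hA.baseSlit hne).restrictionDeriv) :=
  HasRestrictionDeriv.hullProduct _ _ (hA.isRestrictionMap_baseMap hne)
    (hasRestrictionDeriv_ellConf (hA.leftVal_lt_rightVal hne) (hA.rho_pos hne n) (hA.rho_lt_one hne n) (hA.rho_cond hne n))
    (hA.baseSlit hne).hasRestrictionDeriv

/-- **`Φ_{J_n} → Φ_A` uniformly on every `S ⊆ ℍ` with compact closure missing `A'`**: for large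
`n`, `S` misses `J_n` (`eventually_disjoint_of_iInter_eq`), every restriction map of `J_n` is
`Φ_{B_n} ∘ Φ_A` there, and `‖Φ_{B_n}(w) - w‖ ≤ 2h(ρ_n⁻² - 1) → 0` uniformly in `w`.
[cite: LawlerSchrammWerner2003Restriction, Lemma 3.5 (p. 12, convergence notion) and its proof (p. 13, "E_δ → A")] -/
theorem IsPlusHull.tendstoUniformlyOn_arcHull {Φ' : ConformalEquiv (upperHalfPlaneSet \ A) upperHalfPlaneSet}
    {Ψ : ∀ n, ConformalEquiv (upperHalfPlaneSet \ hA.arcHull hne n) upperHalfPlaneSet}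
    (hΦ' : IsRestrictionMap A Φ') (hΨ : ∀ n, IsRestrictionMap (hA.arcHull hne n) (Ψ n))
    {S : Set ℂ} (hS : S ⊆ upperHalfPlaneSet) (hSc : IsCompact (closure S)) (hSd : Disjoint (closure S) (realFill A)) :
    TendstoUniformlyOn (fun n z ↦ Ψ n z) (fun z ↦ Φ' z) atTop S := by
  set a := hA.leftVal hne
  set b := hA.rightVal hne
  have hab : a < b := hA.leftVal_lt_rightVal hne
  have ha : 0 < a := hA.leftVal_pos hne
  rw [Metric.tendstoUniformlyOn_iff]
  intro ε hε
  have hev1 : ∀ᶠ n in atTop, Disjoint (closure S) (hA.arcHull hne n) :=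
    eventually_disjoint_of_iInter_eq (fun n ↦ isClosed_hullProduct) (hA.antitone_arcHull hne)
      (hA.iInter_arcHull hne) hSc hSd
  have hev2 : ∀ᶠ n in atTop, 2 * ellH a b * ((hA.rho hne n ^ 2)⁻¹ - 1) < ε := by
    have h1 : Tendsto (fun n ↦ 2 * ellH a b * ((hA.rho hne n ^ 2)⁻¹ - 1)) atTop
        (𝓝 (2 * ellH a b * (((1 : ℝ) ^ 2)⁻¹ - 1))) :=
      ((((hA.tendsto_rho hne).pow 2).inv₀ (by norm_num)).sub_const 1).const_mul _
    have h0 : 2 * ellH a b * (((1 : ℝ) ^ 2)⁻¹ - 1) = 0 := by norm_num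
    rw [h0] at h1
    exact h1 (Iio_mem_nhds hε)
  filter_upwards [hev1, hev2] with n hn1 hn2 z hzS
  have hzJ : z ∈ upperHalfPlaneSet \ hA.arcHull hne n := ⟨hS hzS, Set.disjoint_left.1 hn1 (subset_closure hzS)⟩
  have hzA : z ∈ upperHalfPlaneSet \ A := ⟨hS hzS, fun h ↦ hzJ.2 (hA.subset_arcHull hne n h)⟩
  rw [hA.eqOn_baseMap hne hΦ' hzA,
    hA.eqOn_of_isRestrictionMap_arcHull hne n (hΨ n) (hA.isRestrictionMap_arcHullMap hne n) hzJ,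
    hA.arcHullMap_apply hne, dist_comm, dist_eq_norm]
  have hD : hA.baseMap hne z ∈ ellDomain a b :=
    upperHalfPlaneSet_subset_ellDomain hab ((hA.baseMap hne).mapsTo hzA)
  exact lt_of_le_of_lt (norm_ellMap_sub_le hab (hA.rho_pos hne n) (hA.rho_lt_one hne n).le ha hD) hn2

/-- **`Φ'_{J_n}(0) ↑ Φ'_A(0)`**: `Φ'_{J_n}(0) = Φ'_{B_n}(0) Φ'_A(0)` with `Φ'_{B_n}(0) = ellDeriv ↑ 1`.
[cite: LawlerSchrammWerner2003Restriction, Lemma 2.1 (p. 8, "the increasing sequence Φ'_{A_n}(0) converges to Φ'_A(0)")] -/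
theorem IsPlusHull.restrictionDeriv_arcHull {Φ' : ConformalEquiv (upperHalfPlaneSet \ A) upperHalfPlaneSet}
    {Ψ : ∀ n, ConformalEquiv (upperHalfPlaneSet \ hA.arcHull hne n) upperHalfPlaneSet}
    (hΦ' : IsRestrictionMap A Φ') (hΨ : ∀ n, IsRestrictionMap (hA.arcHull hne n) (Ψ n))
    {d : ℝ} {dn : ℕ → ℝ} (hd : HasRestrictionDeriv A Φ' d)
    (hdn : ∀ n, HasRestrictionDeriv (hA.arcHull hne n) (Ψ n) (dn n)) :
    Monotone dn ∧ Tendsto dn atTop (𝓝 d) := by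
  set a := hA.leftVal hne
  set b := hA.rightVal hne
  have hab : a < b := hA.leftVal_lt_rightVal hne
  have ha : 0 < a := hA.leftVal_pos hne
  set d₀ : ℝ := (hA.baseSlit hne).restrictionDeriv with hd₀def
  have hd₀ : 0 < d₀ := (hA.baseSlit hne).restrictionDeriv_pos
  -- `d = Φ'_A(0)`
  have hdd : d = d₀ := by
    have h1 : HasRestrictionDeriv A (hA.baseMap hne) d := by
      refine (hd : Tendsto _ _ _).congr' ?_
      filter_upwards [self_mem_nhdsWithin] with z hz
      show Φ' z / z = hA.baseMap hne z / z
      rw [hA.eqOn_baseMap hne hΦ' hz]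
    exact HasRestrictionDeriv.unique hA.1 h1 (hA.baseSlit hne).hasRestrictionDeriv
  -- `dn n = Φ'_{B_n}(0) Φ'_A(0)`
  have hdn' : ∀ n, dn n = ellDeriv a b (hA.rho hne n) * d₀ := fun n ↦ by
    have h1 : HasRestrictionDeriv (hA.arcHull hne n) (hA.arcHullMap hne n) (dn n) := by
      refine (hdn n : Tendsto _ _ _).congr' ?_
      filter_upwards [self_mem_nhdsWithin] with z hz
      show Ψ n z / z = hA.arcHullMap hne n z / z
      rw [hA.eqOn_of_isRestrictionMap_arcHull hne n (hΨ n) (hA.isRestrictionMap_arcHullMap hne n) hz]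
    exact HasRestrictionDeriv.unique (hA.isStarHull_arcHull hne n) h1 (hA.hasRestrictionDeriv_arcHullMap hne n)
  refine ⟨fun m n hmn ↦ ?_, ?_⟩
  · rw [hdn' m, hdn' n]
    exact mul_le_mul_of_nonneg_right (ellDeriv_mono hab ha (hA.rho_pos hne m) (hA.rho_mono hne hmn)) hd₀.le
  · have h1 : Tendsto (fun n ↦ ellDeriv a b (hA.rho hne n) * d₀) atTop (𝓝 (ellDeriv a b 1 * d₀)) :=
      ((tendsto_ellDeriv a b).comp (hA.tendsto_rho hne)).mul_const _
    rw [ellDeriv_one hab ha, one_mul] at h1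
    rw [hdd]
    exact h1.congr fun n ↦ (hdn' n).symm

end Convergence

/-! ### [LSW] Lemma 2.1 with the convergence of Lemma 3.5 -/

/-- **[LSW] Lemma 2.1, with the convergence of the restriction maps of Lemma 3.5, holds**
(`Literature.Probability.RandomPlanarGeometry.IsPlusHull.exists_antitone_isArcHull`): for a nonempty `A ∈ 𝒬₊` the smooth `+`-hulls
`J_n = B_n · A` — `B_n` the half-ellipse hull with foci `a = Φ_A(x₀)`, `b = Φ_A(x₁)` and radius
parameter `ρ_n ↑ 1`, i.e. `ℍ ∖ J_n = Φ_A⁻¹(ℍ ∖ B_n)` ("the image under `Φ_A⁻¹` of appropriately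
chosen paths", [LSW] p. 8; the sets `E_δ` of p. 13 with `D_δ` replaced by confocal half-ellipses)
— decrease to `A' = A ∪ [x₀, x₁]`, every restriction map of `J_n` converges to `Φ_A` uniformly on
the admissible sets `S`, and `Φ'_{J_n}(0) = Φ'_{B_n}(0) Φ'_A(0)` increases to `Φ'_A(0)`.
[cite: LawlerSchrammWerner2003Restriction, Lemma 2.1 and its proof (p. 8); Lemma 3.5 and its proof (pp. 12–13)] -/
theorem IsPlusHull.exists_antitone_isArcHull_holds : IsPlusHull.exists_antitone_isArcHull := by
  intro A hA hne
  exact ⟨hA.arcHull hne, hA.isArcHull_arcHull hne, hA.isPlusHull_arcHull hne, hA.antitone_arcHull hne,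
    hA.iInter_arcHull hne, fun hΦ hΨ ↦ ⟨fun S hS hSc hSd ↦ hA.tendstoUniformlyOn_arcHull hne hΦ hΨ hS hSc hSd,
      fun hd hdn ↦ hA.restrictionDeriv_arcHull hne hΦ hΨ hd hdn⟩⟩

end Literature.Probability.RandomPlanarGeometry
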